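import Literature.AlgebraicGeometry.Resolution.AlterationsSemiStableResolution
import Literature.AlgebraicGeometry.Motives.SubschemeCyclesFlatPullbackProofs
import Mathlib.AlgebraicGeometry.IdealSheaf.Subscheme
import Mathlib.AlgebraicGeometry.Fiber
import Mathlib.AlgebraicGeometry.FunctionField
import Mathlib.AlgebraicGeometry.Morphisms.Proper
import Mathlib.AlgebraicGeometry.Morphisms.ClosedImmersion
import Mathlib.AlgebraicGeometry.Morphisms.Flat
import HarnessLib

/-!
# The strict transform of a morphism along a base change (de Jong 1996, 2.18)

Topic: `Literature/AlgebraicGeometry/Resolution`. De Jong 1996, 2.18: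

> "Let `f : X → S` be a morphism of finite type, with `S` Noetherian and integral. Let
> `ψ : S' → S` be a modification. We consider the diagram `X' → X ×_S S' → X` over
> `S' = S' → S`. Here `X'` is the closed subscheme of `X ×_S S'` given by dividing the
> `𝒪_{S'}`-torsion out of `𝒪_{X ×_S S'}`; we remark that `X'` may be empty, even if `S' = S`.
> The morphism `f' : X' → S'` is called the strict transform of `f` (with respect to `ψ`).
> […] There exists a nonempty open subscheme `U ⊂ S` such that `X_U → U` is flat, see 2.7.
> Clearly, `X'|_{ψ⁻¹(U)} ≅ X ×_S ψ⁻¹(U)` and `X'` is the schematic closure of this in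
> `X ×_S S'`. Thus if `X` is integral and dominates `S`, then `X' → X` is a modification as
> well." (p. 60)

and 2.20: "One can define the strict transform of a morphism `f : X → S` with respect to
alterations as in 2.18." (p. 61); it is used in 4.15 ("`X'` is the reduction of the scheme
`Y' ×_Y X`, i.e. `f'` is the strict transform of `f` with respect to the alteration `ψ`"),
4.18 and 4.22.

This file DEFINES the strict transform for any `f : X → S` and any `ψ : S' → S` with `S'`
integral, as the scheme-theoretic closure in `X ×_S S'` of the GENERIC FIBRE of
`X ×_S S' → S'`:

* `strictTransform f ψ = im((X ×_S S')_{η'} → X ×_S S')`, Mathlib's scheme-theoretic image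
  (`Scheme.Hom.image`, the closed subscheme of the kernel ideal sheaf `Scheme.Hom.ker`) of the
  inclusion of the scheme-theoretic fibre (`Scheme.Hom.fiberι`) over the generic point `η'`
  of `S'`; with `strictTransformι : strictTransform f ψ → X ×_S S'` (a closed immersion),
  `strictTransformMap f ψ : strictTransform f ψ → S'` (de Jong's `f'`) and
  `strictTransformFst f ψ : strictTransform f ψ → X` (de Jong's `X' → X`, the `φ` of 4.15).

Why this is 2.18: on an affine open `Spec B` of `X ×_S S'` over an affine open `Spec A'` of
the integral `S'`, `K' = Frac A' = κ(η')`, the kernel of `B → B ⊗_{A'} K'` is exactly the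
`A'`-torsion of `B`, so the ideal sheaf of the scheme-theoretic image of the generic fibre
(computed affine-locally, the inclusion of the generic fibre being quasi-compact,
`Literature.AlgebraicGeometry.Motives.quasiCompact_fiberι`) is the sheaf of `𝒪_{S'}`-torsion
sections, i.e. our `X'` is de Jong's "closed subscheme given by dividing the `𝒪_{S'}`-torsion out". Equivalently (loc. cit.)
it is the schematic closure of `X ×_S ψ⁻¹(U)` for any non-empty open `U ⊆ S` over which `X` is
flat (a flat scheme over an integral base is the schematic closure of its generic fibre). No
hypothesis on `ψ` is needed for the definition (2.20 uses it for alterations, 4.15 for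
generically étale projective alterations, 4.18/4.22 for modifications).

Proved API: the structure maps and their compatibility (`strictTransformMap_comp`), the
closed immersion, properness/separatedness/finite-type of `f'` inherited from `f`, the
factorisation of the generic fibre through `X'` (`toStrictTransform`, dominant), and the
underlying set: `X'` is the closure of the generic fibre of `X ×_S S' → S'`
(`range_strictTransformι`).

The remaining statements of 2.18 are vendored as NAMED FACTS, both since DISCHARGED:
`DeJong1996StrictTransformFlatLocus` ("`X'|_{ψ⁻¹(U)} ≅ X ×_S ψ⁻¹(U)`" for `X` flat over `U`;
`DeJong1996StrictTransformFlatLocus_holds`, `StrictTransformFlatLocus.lean`) and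
`DeJong1996StrictTransformModification` ("if `X` is integral and dominates `S`, then `X' → X` is
a modification as well", `IsModification`; `DeJong1996StrictTransformModification_holds`,
`StrictTransformModificationProofs.lean`). The flattening of 2.19 ([22] = Raynaud–Gruson 1971,
Thm. 5.2.2), in the form used in 4.18 over a field (for `f : X → S` a morphism of projective
`k`-schemes, `S` a variety, flat over the non-empty open `U`, there is a projective modification
`ψ : S' → S`, an isomorphism over `U`, whose strict transform `f'` is flat), is NOT a named fact
of this file: it is the theorem `DeJong1996.flattening_of_stacks081R` of
`StrictTransformFlattening.lean`, PROVED there from Raynaud–Gruson's flattening theorem (the named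
fact `Stacks081R`, Stacks Tag 081R) via the uniqueness clause of 2.18. (It was first vendored
here as a named fact `DeJong1996Flattening`; under D-0026 that intermediate fact was merged into
the proved theorem, leaving `Stacks081R` as the single leaf.)

## Sources

* A. J. de Jong, *Smoothness, semi-stability and alterations*, Publ. Math. IHÉS 83 (1996) 51–93:
  2.7, 2.17, 2.18, 2.19, 2.20 (pp. 59–61), 4.15 (p. 71), 4.18 (p. 72).
* M. Raynaud, L. Gruson, *Critères de platitude et de projectivité*, Invent. Math. 13 (1971)
  1–89, Thm. 5.2.2 (= [22] of de Jong 1996).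
* The Stacks Project, Tag 01R5 (scheme-theoretic image), Tag 080C (strict transform).
-/

noncomputable section

open CategoryTheory CategoryTheory.Limits AlgebraicGeometry TopologicalSpace Topology

namespace Literature.AlgebraicGeometry.Resolution

universe u

/-! ## The strict transform -/

section StrictTransform

variable {X S S' : Scheme.{u}} (f : X ⟶ S) (ψ : S' ⟶ S) [IsIntegral S']

/-- **The strict transform** of `f : X → S` with respect to `ψ : S' → S`, `S'` integral (de Jong
1996, 2.18, 2.20): the closed subscheme `X'` of `X ×_S S'` "given by dividing the
`𝒪_{S'}`-torsion out of `𝒪_{X ×_S S'}`", rendered as the scheme-theoretic image (Mathlib's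
`Scheme.Hom.image`) of the scheme-theoretic fibre of `X ×_S S' → S'` over the generic point of
`S'` — affine-locally the kernel of `B → B ⊗_{A'} Frac(A')` is the `A'`-torsion of `B`.
[cite: DeJong1996, 2.18, p. 60] -/
def strictTransform : Scheme.{u} :=
  ((pullback.snd f ψ).fiberι (genericPoint S')).image

/-- The closed immersion `X' ↪ X ×_S S'` of the strict transform (de Jong 1996, 2.18: "`X'` is
the closed subscheme of `X ×_S S'` given by …"). [cite: DeJong1996, 2.18, p. 60] -/
def strictTransformι : strictTransform f ψ ⟶ pullback f ψ :=
  ((pullback.snd f ψ).fiberι (genericPoint S')).imageι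

/-- The strict transform `f' : X' → S'` of `f` with respect to `ψ` (de Jong 1996, 2.18: "The
morphism `f' : X' → S'` is called the strict transform of `f`"). [cite: DeJong1996, 2.18, p. 60] -/
def strictTransformMap : strictTransform f ψ ⟶ S' :=
  strictTransformι f ψ ≫ pullback.snd f ψ

/-- The projection `X' → X` of the strict transform (de Jong 1996, 2.18: "`X' → X ×_S S' → X`";
the `φ : X' → X` of 4.15). [cite: DeJong1996, 2.18, p. 60] -/
def strictTransformFst : strictTransform f ψ ⟶ X :=
  strictTransformι f ψ ≫ pullback.fst f ψ

/-- The generic fibre of `X ×_S S' → S'` maps (dominantly) to the strict transform.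
[folklore] -/
def toStrictTransform : (pullback.snd f ψ).fiber (genericPoint S') ⟶ strictTransform f ψ :=
  ((pullback.snd f ψ).fiberι (genericPoint S')).toImage

/-- `X' ↪ X ×_S S'` is a closed immersion. [folklore] -/
instance isClosedImmersion_strictTransformι : IsClosedImmersion (strictTransformι f ψ) :=
  inferInstanceAs
    (IsClosedImmersion ((pullback.snd f ψ).fiberι (genericPoint S')).ker.subschemeι)

/-- The generic fibre factors through the strict transform. [folklore] -/
@[reassoc (attr := simp)]
theorem toStrictTransform_ι :
    toStrictTransform f ψ ≫ strictTransformι f ψ = (pullback.snd f ψ).fiberι (genericPoint S') :=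
  Scheme.Hom.toImage_imageι _

/-- The generic fibre is dense in the strict transform (scheme-theoretically dominant, in
fact). [folklore] -/
instance isDominant_toStrictTransform : IsDominant (toStrictTransform f ψ) :=
  haveI := Literature.AlgebraicGeometry.Motives.quasiCompact_fiberι (pullback.snd f ψ) (genericPoint S')
  inferInstanceAs (IsDominant ((pullback.snd f ψ).fiberι (genericPoint S')).toImage)

/-- The square of the strict transform commutes: `f' ≫ ψ = (X' → X) ≫ f`. [folklore] -/
@[reassoc]
theorem strictTransformMap_comp :
    strictTransformMap f ψ ≫ ψ = strictTransformFst f ψ ≫ f := by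
  simp only [strictTransformMap, strictTransformFst, Category.assoc, pullback.condition]

/-- Unfolding `strictTransformMap`. [folklore] -/
theorem strictTransformι_snd : strictTransformι f ψ ≫ pullback.snd f ψ = strictTransformMap f ψ :=
  rfl

/-- Unfolding `strictTransformFst`. [folklore] -/
theorem strictTransformι_fst : strictTransformι f ψ ≫ pullback.fst f ψ = strictTransformFst f ψ :=
  rfl

/-- **The underlying set of the strict transform is the closure of the generic fibre of
`X ×_S S' → S'`** (the scheme-theoretic image of a quasi-compact morphism has the closure of
the image as underlying set, Stacks 01R8). [folklore] -/
theorem range_strictTransformι :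
    Set.range (strictTransformι f ψ) = closure ((pullback.snd f ψ) ⁻¹' {genericPoint S'}) := by
  haveI := Literature.AlgebraicGeometry.Motives.quasiCompact_fiberι (pullback.snd f ψ) (genericPoint S')
  have h := Scheme.IdealSheafData.range_subschemeι
    ((pullback.snd f ψ).fiberι (genericPoint S')).ker
  rw [Scheme.Hom.support_ker, Scheme.Hom.range_fiberι] at h
  exact h

/-- Every point of the strict transform specialises from a point of the generic fibre; in
particular `f'` is dominant when the generic fibre of `X ×_S S' → S'` is non-empty. Recorded as:
the image of `X'` in `S'` lies in the closure of `{η'}`, i.e. imposes nothing — but the image of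
`X' → X ×_S S'` lies in the closure of the generic fibre. [folklore] -/
theorem strictTransformι_apply_mem (x : strictTransform f ψ) :
    strictTransformι f ψ x ∈ closure ((pullback.snd f ψ) ⁻¹' {genericPoint S'}) := by
  rw [← range_strictTransformι]
  exact ⟨x, rfl⟩

/-- `f'` is separated when `f` is. [folklore] -/
instance isSeparated_strictTransformMap [IsSeparated f] : IsSeparated (strictTransformMap f ψ) := by
  delta strictTransformMap
  infer_instance

/-- `f'` is proper when `f` is (a closed immersion followed by a base change of `f`).
[folklore] -/
instance isProper_strictTransformMap [IsProper f] : IsProper (strictTransformMap f ψ) := by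
  delta strictTransformMap
  infer_instance

/-- `f'` is locally of finite type when `f` is. [folklore] -/
instance locallyOfFiniteType_strictTransformMap [LocallyOfFiniteType f] :
    LocallyOfFiniteType (strictTransformMap f ψ) := by
  delta strictTransformMap
  infer_instance

/-- `f'` is quasi-compact when `f` is. [folklore] -/
instance quasiCompact_strictTransformMap [QuasiCompact f] :
    QuasiCompact (strictTransformMap f ψ) := by
  delta strictTransformMap
  infer_instance

/-- `X' → X` is separated when `ψ` is. [folklore] -/
instance isSeparated_strictTransformFst [IsSeparated ψ] : IsSeparated (strictTransformFst f ψ) := by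
  delta strictTransformFst
  infer_instance

/-- `X' → X` is proper when `ψ` is. [folklore] -/
instance isProper_strictTransformFst [IsProper ψ] : IsProper (strictTransformFst f ψ) := by
  delta strictTransformFst
  infer_instance

/-- The image of `X' → X ×_S S' → S'` followed by `ψ` agrees pointwise with `X' → X → S`.
[folklore] -/
theorem ψ_strictTransformMap_apply (x : strictTransform f ψ) :
    ψ (strictTransformMap f ψ x) = f (strictTransformFst f ψ x) := by
  rw [← Scheme.Hom.comp_apply, strictTransformMap_comp, Scheme.Hom.comp_apply]

end StrictTransform

/-! ## 2.18 (flat locus, modifications) as named facts (2.19: `StrictTransformFlattening.lean`) -/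

/-- NAMED FACT — **de Jong 1996, 2.18: the strict transform does nothing over the flat locus.**
"There exists a nonempty open subscheme `U ⊂ S` such that `X_U → U` is flat, see 2.7. Clearly,
`X'|_{ψ⁻¹(U)} ≅ X ×_S ψ⁻¹(U)`". Rendered: for every open `U ⊆ S` over which `f` is flat, the
closed immersion `X' ↪ X ×_S S'` is an isomorphism over the open `X ×_S ψ⁻¹(U)` of `X ×_S S'`
(affine-locally: a flat algebra over a domain has no torsion, so the kernel of
`B → B ⊗_{A'} Frac(A')` vanishes). No Noetherian or finiteness hypothesis is needed for this
part. Users take `(h : DeJong1996StrictTransformFlatLocus)`.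
[cite: DeJong1996, 2.18, p. 60] -/
def DeJong1996StrictTransformFlatLocus : Prop :=
  ∀ (X S S' : Scheme.{u}) (f : X ⟶ S) (ψ : S' ⟶ S) [IsIntegral S'] (U : S.Opens),
    Flat (f ∣_ U) → IsIso (strictTransformι f ψ ∣_ (pullback.snd f ψ) ⁻¹ᵁ (ψ ⁻¹ᵁ U))

/-- NAMED FACT — **de Jong 1996, 2.18: the strict transform of an integral dominating `X` along
a modification is a modification.** "Let `f : X → S` be a morphism of finite type, with `S`
Noetherian and integral. Let `ψ : S' → S` be a modification. […] Thus if `X` is integral and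
dominates `S`, then `X' → X` is a modification as well." (`IsModification`, 2.17: `X'`
integral, `X' → X` proper and birational.) Users take
`(h : DeJong1996StrictTransformModification)`. [cite: DeJong1996, 2.18, p. 60] -/
def DeJong1996StrictTransformModification : Prop :=
  ∀ (X S S' : Scheme.{u}) [IsIntegral X] [IsIntegral S] [IsNoetherian S] (f : X ⟶ S)
    [LocallyOfFiniteType f] [QuasiCompact f] [IsDominant f] (ψ : S' ⟶ S) [IsIntegral S'],
    IsModification ψ → IsModification (strictTransformFst f ψ)

end Literature.AlgebraicGeometry.Resolution

end
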